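import Summits.AnomalousDissipation.AnomalousDissipation.Theses.MarginalStabilityChain
import Literature.Analysis.FluidPDE.StretchedLayerNS

/-!
# Line `stationary-measure-concentration-fixed-point` — checked skeleton for crux
# `MarginalStabilityChain.StretchedVortexRows` (stmt-AnomalousDissipation-3009, rank 4,
# route-AnomalousDissipation-MarginalStabilityChain)

Planner crux-plan, round 1 (planner-cruxplan-stmt-AnomalousDissipation-3009-stationary-measure-c-0,
2026-08-16), from crux idea card `Cruxes/StretchedVortexRows/Ideas/stationary-measure-concentration-fixed-point.md`
(ideator 1; triage TRIAGE-r1-{1,2,3}: pass ×3, sharpenings acted on below). Prose: the line card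
`Lines/stationary-measure-concentration-fixed-point.md`.

## The line in one paragraph

Because the transverse field `U = (u, v − y)` of the stretched class has `div U = −1`, the steady vorticity
equation is EXACTLY the stationary Fokker–Planck equation `νΔρ = div(Uρ)` for `ρ = −ω/L`: a steady
one-signed state is a SELF-CONSISTENT STATIONARY LAW of the planar diffusion driven by its own periodic
Biot–Savart field plus compression. Frame (§1–2): states are Gaussian-weighted bounded continuous densities
`g = e^{y²}ρ` on `ℝ²` (`E = ℝ² →ᵇ ℝ`); the class `C = admissible L` (periodic, POINT-SYMMETRIC, `ρ ≥ 0`,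
unit mass per cell) is closed convex; the frozen-field operator `T(h) = e^{y²}·π(U_h)` (`Tmap`; `π(U_h)` =
the stationary law of the LINEAR diffusion in the frozen field of `ρ_h`, `statLaw`, weak formulation) is a
compact continuous self-map of bounded parts of `C` (`FrozenFrame`); the homotopy
`H_θ = T(θ· + (1−θ)g_row)` (`Hmap`) freezes the self-interaction, and its `θ = 0` end is the CONSTANT map
onto the law of the frozen Gaussian-row field — so the Leray–Schauder argument needs NO degree theory, only
the nonlinear alternative (`LeraySchauderAlternative`, provable from the tree's Schauder theorem), the base
point inside the tube `Ω = {‖g‖ < R} ∩ {m_L < Mν}` (`FrozenRowConcentration`: the frozen-row law has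
concentration moment `≤ M₀ν`), and the a-priori estimate that NO `θ`-self-consistent state sits on `∂Ω`
(`APrioriConcentrationGap`, HARDEST: weighted sup bound from the universal `div U = −1` identities + the
CONCENTRATION GAP). The fixed point is a classical steady state (`FrozenFrame` (D) bootstrap +
`SteadyOfVorticityForm` pressure reconstruction) with `m_L < Mν`, and the floor `layerDissipation ≥ L/(64M)`
is read off the concentration (`FloorFromConcentration`); period multiplication (Disproof §7, re-proved here)
carries the short-period statement `RowsSmallPeriod` to every `L`. `StretchedVortexRows_of` concludes the
crux BY NAME from the six stubs; `lineComposition`, `rowsSmallPeriod_of`, `typed_of_rowsSmallPeriod` and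
`stretchedVortexRows_iff_typed` are real proofs (axioms `propext, Classical.choice, Quot.sound`).

## Registered stubs (6; `def … : Prop` statement + `theorem stub_… : … := by sorry`)

* `SteadyOfVorticityForm` / `stub_steadyOfVorticityForm` (S1, M) — smooth bounded periodic div-free field,
  shear far field, Gaussian-tailed vorticity solving the steady vorticity equation ⇒ `∃ p`,
  `IsSteadyStretchedLayerNSSolution ν 1 1 L u v p` (curl-free momentum residual, Poincaré lemma, period
  defect of `p` vanishes by the far field).
* `FrozenFrame` / `stub_frozenFrame` (S2, L) — the linear theory: `admissible` closed convex, `m_L`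
  continuous; frozen laws exist (Khasminskii, Lyapunov `y²`) and `T` maps admissible to admissible
  (uniqueness ⇒ point symmetry; tails `e^{−y²/2ν}` ⇒ weighted-bounded for `ν ≤ ¼`); `T` continuous and
  compact on bounded parts (BKRS uniqueness, De Giorgi/Schauder + uniform tails); fixed points are `C^∞`
  classical self-consistent states with curl `−Lρ` (bootstrap).
* `LeraySchauderAlternative` / `stub_leraySchauderAlternative` (S3, M; Mathlib + tree only, reusable) —
  Granas' nonlinear alternative for compact homotopies with a constant end, from
  `Literature.Analysis.Convex.exists_fixedPoint_of_isCompact_closure` + Urysohn.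
* `APrioriConcentrationGap` / `stub_aprioriConcentrationGap` (S4, XL, HARDEST; the lead holds it) —
  `∃ M₁ ∀ M ≥ M₁ ∃ L⋆ ∀ L ≤ L⋆ ∃ ν₀ ∀ ν ≤ ν₀ ∃ R`: every admissible `θ`-fixed point with `m_L ≤ Mν` has
  `‖g‖ < R` and `m_L < Mν` (concentration dichotomy: cores of area `O(ν)` or layer-like states with
  `m_L ≳ L²`, nothing in between; area-Lyapunov function + virial identities; threat family = staggered
  unequal pairs, triage r1-1).
* `FrozenRowConcentration` / `stub_frozenRowConcentration` (S5, M–L) — the Gaussian row is an admissible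
  state and EVERY stationary law of ITS frozen field has `∫_cell π w_L ≤ M₀ν` (linear problem; kit
  evidence `m/ν ≈ 4.0–5.6`, triage r1-1 j010784, r1-3 j010795/j013360).
* `FloorFromConcentration` / `stub_floorFromConcentration` (S6, M) — `ω = −Lρ`, `∫_cell ρ w_L ≤ Mν`,
  `32Mν ≤ L²` ⇒ `layerDissipation ≥ L/(64M)` (Chebyshev + periodicity + Cauchy–Schwarz; the ball form is
  already PROVED, triage r1-2 evidence `FloorFromConcentration.lean`).

## Disproof.lean / negatives / triage honoured (Cruxes/StretchedVortexRows/Disproof.lean, cdisprove,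
## 2026-08-16T05:01Z, read in full)

* No `_false_without_<H>` theorem and no landed `Theorems/StretchedVortexRows*/Negative` lemma exist; the
  obligations the file does record are honoured: §1 ⊤-loophole (`stretchedVortexRows_of_infinite_witnesses`)
  — NOT used: the witness is Gaussian-tailed and smooth, its dissipation is read off a genuine `L²` bound
  (S6), and it meets the disprover's repair C″ (`StretchedVortexRowsRepairedRow`: Gaussian vorticity bound,
  `ω = −Lρ ≤ 0`, finite dissipation) except that finiteness is not separately recorded; §3
  `not_stretchedVortexRowsParallel` / `rigidity_of_v_zero` (the witness must be non-parallel) — the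
  moment constraint `m_L < Mν ≪ L²/24 ≈ m_L(layer)` excludes the Burgers layer from `Ω`, so the fixed point
  is genuinely two-dimensional; §7 period multiplication — re-proved here (`layerDissipation_nat_mul`,
  `typed_of_rowsSmallPeriod`) with threshold `L⋆ ≤ 1` instead of `1`; §0 typed form — re-proved verbatim
  (`stretchedVortexRows_iff_typed`); §5 item 2 (alternating-sign zoo, `sup D = ∞`) — irrelevant to a
  one-signed construction; §5 item 3 (the only failure mode is a Liouville theorem "every steady state is the
  layer") — this is exactly what S3+S4+S5 decide.
* `ledger negatives --problem AnomalousDissipation` (2026-08-16): 5 refuted statements, all `T³`-side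
  (TaylorCertificates 13037, Correlation 0204, FrustratedForces 2979/2984, DebrisQuanta 2859) — no stub is an
  instance of any.
* Triage sharpenings acted on: (r1-2, r1-3) the line is the LERAY–SCHAUDER variant from the start, not plain
  Schauder invariance of `K_M` (two-blob members exit `K_M`); (r1-1) positivity/one-signedness comes from the
  state BEING an invariant probability density (`admissible`, `IsFrozenLaw`), not from a maximum principle;
  (r1-1) the staggered-unequal-pair threat family is named in S4's docstring; (r1-2/3) Schauder IS in tree —
  S3 is stated so that it follows from it (no LS degree); (r1-3) the base point is the frozen GAUSSIAN row
  (smooth drift), whose law is numerically inside `K_8`.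
-/

noncomputable section

set_option linter.dupNamespace false
set_option linter.unusedVariables false

open Set Function Filter Topology MeasureTheory
open scoped ENNReal ContDiff BoundedContinuousFunction

namespace Summit.AnomalousDissipation.AnomalousDissipation.Cruxes.StretchedVortexRows.StationaryMeasure

open Summit.AnomalousDissipation.AnomalousDissipation.Theses.MarginalStabilityChain
open Literature.Analysis.FluidPDE Literature.Analysis.FluidPDE.StretchedLayer

/-! ## §1 The frame: weighted densities on the period cell of the cylinder -/

/-- One period cell of the cylinder `(ℝ/Lℤ) × ℝ`, as a subset of `ℝ²`: `(0, L] × ℝ`. -/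
def cell (L : ℝ) : Set (ℝ × ℝ) := Set.Ioc 0 L ×ˢ Set.univ

/-- The vortex lattice `Lℤ × {0}` (the row sits at the lattice points). -/
def lattice (L : ℝ) : Set (ℝ × ℝ) := Set.range fun n : ℤ => ((n : ℝ) * L, (0 : ℝ))

/-- The CONCENTRATION WEIGHT `w_L(q) = min(dist_∞(q, Lℤ×{0})², L²/16)` (sup-metric distance to the
lattice, squared, capped at the quarter-period scale). `∫ ρ w_L` small ⇔ the density sits in small
squares around the lattice points. -/
def wgt (L : ℝ) (q : ℝ × ℝ) : ℝ := min (Metric.infDist q (lattice L) ^ 2) (L ^ 2 / 16)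

/-- The state space of the Leray–Schauder frame: bounded continuous `g : ℝ² → ℝ` (sup norm). An element
represents the Gaussian-WEIGHTED density `ρ = g·e^{−y²}` (`dens`), so the sup norm of `g` encodes Gaussian
tails in `y` and the cell mass / moment functionals are continuous. Periodicity in `x` and the POINT
SYMMETRY `g(−x,−y) = g(x,y)` (the exact symmetry `S` of system and far field that kills `x`-translations)
are imposed in the closed convex class `admissible L`, not in the space. -/
abbrev E : Type := ℝ × ℝ →ᵇ ℝ

/-- The density represented by `g ∈ E`: `ρ_g(x, y) = g(x, y)·e^{−y²}`. -/
def dens (g : E) (q : ℝ × ℝ) : ℝ := g q * Real.exp (-(q.2 ^ 2))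

/-- Mass of `ρ_g` per period cell. -/
def mass (L : ℝ) (g : E) : ℝ := ∫ q in cell L, dens g q

/-- The CONCENTRATION MOMENT `m_L(g) = ∫_cell ρ_g · w_L` (the functional that defines the class `K_M` of
the idea card: `m_L ≤ Mν` = "cores of area `O(ν)` at the lattice points"; the Burgers-row value is `≈ 4ν`,
the Burgers layer has `m_L = L²/16·(1 − O(√ν/L))`). -/
def mom (L : ℝ) (g : E) : ℝ := ∫ q in cell L, dens g q * wgt L q

/-- ADMISSIBLE states: `L`-periodic in `x`, point-symmetric, nonnegative densities of unit mass per cell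
(probability densities on the cylinder cell; `ρ = −ω/L` for a one-signed vorticity of circulation `−L` per
period). Closed and convex in `E` (four closed convex constraints). -/
def admissible (L : ℝ) : Set E :=
  {g | (∀ q : ℝ × ℝ, g (q.1 + L, q.2) = g q) ∧ (∀ q : ℝ × ℝ, g (-q.1, -q.2) = g q) ∧ (∀ q, 0 ≤ g q) ∧
    mass L g = 1}

/-- Re-read a raw function `ℝ² → ℝ` as an element of `E` when it is one (else `0`). -/
def toE (f : ℝ × ℝ → ℝ) : E := by
  classical exact if h : ∃ g : E, (g : ℝ × ℝ → ℝ) = f then h.choose else 0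

/-! ## §2 Biot–Savart on the cylinder and the frozen-field (linear Fokker–Planck) operator -/

/-- `x`-velocity kernel of the `L`-periodic Biot–Savart law: `sinh Y / (cosh Y − cos X)`,
`(X, Y) = 2π(δx, δy)/L` (from `u − iv = (2Li)⁻¹ ∫∫ ω(ζ) cot(π(z − ζ)/L) dA`). -/
def kerU (L a b : ℝ) : ℝ :=
  Real.sinh (2 * Real.pi * b / L) / (Real.cosh (2 * Real.pi * b / L) - Real.cos (2 * Real.pi * a / L))

/-- `y`-velocity kernel of the `L`-periodic Biot–Savart law: `sin X / (cosh Y − cos X)`. -/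
def kerV (L a b : ℝ) : ℝ :=
  Real.sin (2 * Real.pi * a / L) / (Real.cosh (2 * Real.pi * b / L) - Real.cos (2 * Real.pi * a / L))

/-- The `x`-velocity of the vorticity `ω = −L ρ` (one period of a density `ρ` on the cell), INCLUDING the
shear far field: `u_ρ(x,y) = ½ ∫_cell ρ(ξ,η) kerU(x−ξ, y−η)`; `u_ρ → ±½·(cell mass)` as `y → ±∞`, and for
the point row `ρ → δ_{Lℤ×{0}}` it is the co-rotating-row field `−½ Re cot(πz/L)…`. -/
def velU (L : ℝ) (ρ : ℝ × ℝ → ℝ) (x y : ℝ) : ℝ :=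
  (1 / 2) * ∫ ξ in Set.Ioc 0 L, ∫ η, ρ (ξ, η) * kerU L (x - ξ) (y - η)

/-- The `y`-velocity of the vorticity `ω = −L ρ`: `v_ρ(x,y) = −½ ∫_cell ρ(ξ,η) kerV(x−ξ, y−η)` (`→ 0` as
`|y| → ∞`; for a point vortex of circulation `−L` at `0` it is `−½ cot(πx/L) ≈ −L/(2πx)` on `y = 0`). -/
def velV (L : ℝ) (ρ : ℝ × ℝ → ℝ) (x y : ℝ) : ℝ :=
  -(1 / 2) * ∫ ξ in Set.Ioc 0 L, ∫ η, ρ (ξ, η) * kerV L (x - ξ) (y - η)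

/-- The planar vorticity `ω = ∂ₓv − ∂_yu` of curried plane fields. -/
def vort (u v : ℝ → ℝ → ℝ) (x y : ℝ) : ℝ := dX v x y - dY u x y

/-- FROZEN LAW: `π` is a continuous stationary probability density (per cell) of the LINEAR Fokker–Planck
equation `νΔπ = ∂ₓ(U π) + ∂_y((V − y) π)` in the frozen transverse field `(U, V − y)` (velocity `(U,V)`
plus the compression `−y e_y`; `div = −1`), in the WEAK (distributional) sense on `ℝ²` — tested against
compactly supported `C²` functions: `∫ π (νΔφ + U∂ₓφ + (V − y)∂_yφ) = 0` — `L`-periodic in `x`, with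
Gaussian `y`-tails at the frame's rate `e^{−y²}` (any stationary law has tails `e^{−y²/2ν(1+o(1))}`, so
this is no restriction for `ν ≤ ¼`). It is the invariant density of `dX = (U, V − y)(X) dt + √(2ν) dB` on
the cylinder. (Weak, because the Biot–Savart field of a merely continuous density is log-Lipschitz, not
`C¹`: the frozen law is `C^{1,α}`, classical only after the bootstrap at a fixed point, `FrozenFrame` (D).) -/
def IsFrozenLaw (ν L : ℝ) (U V : ℝ → ℝ → ℝ) (π : ℝ → ℝ → ℝ) : Prop :=
  Continuous (fun q : ℝ × ℝ => π q.1 q.2) ∧ (∀ x y, π (x + L) y = π x y) ∧ (∀ x y, 0 ≤ π x y) ∧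
    (∫ q in cell L, π q.1 q.2 = 1) ∧ (∃ C : ℝ, ∀ x y, |π x y| ≤ C * Real.exp (-(y ^ 2))) ∧
    ∀ φ : ℝ → ℝ → ℝ, ContDiff ℝ 2 (fun q : ℝ × ℝ => φ q.1 q.2) →
      HasCompactSupport (fun q : ℝ × ℝ => φ q.1 q.2) →
      ∫ q : ℝ × ℝ, π q.1 q.2 *
        (ν * lap φ q.1 q.2 + U q.1 q.2 * dX φ q.1 q.2 + (V q.1 q.2 - q.2) * dY φ q.1 q.2) = 0

/-- The frozen law of the field `(U, V − y)` when one exists (else `0`); `FrozenFrame` asserts existence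
(and its proof, uniqueness) for the Biot–Savart fields of admissible densities. -/
def statLaw (ν L : ℝ) (U V : ℝ → ℝ → ℝ) : ℝ → ℝ → ℝ := by
  classical exact if h : ∃ π, IsFrozenLaw ν L U V π then h.choose else fun _ _ => 0

/-- THE FROZEN-FIELD OPERATOR `T : E → E`, `T(h) = e^{y²}·π(U_h)`: the (weighted) stationary law of
the linear diffusion in the FROZEN transverse field of the density `ρ_h` (Biot–Savart of `ω = −Lρ_h` with
the shear far field, plus compression). Its fixed points in `admissible L` are exactly the self-consistent
stationary densities = steady one-signed states of the stretched 2-D Navier–Stokes class (`SteadyOfVorticityForm`). -/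
def Tmap (ν L : ℝ) (h : E) : E :=
  toE fun q => Real.exp (q.2 ^ 2) * statLaw ν L (velU L (dens h)) (velV L (dens h)) q.1 q.2

/-- The Gaussian (Burgers) vortex row as a density: `ρ_row = Σ_n (4πν)⁻¹ e^{−((x−nL)² + y²)/4ν}` (unit mass
per cell, point-symmetric; `ω = −Lρ_row` is the periodised Burgers vortex of circulation `−L`). Its frozen
field `(u_row, v_row − y)` is the homotopy's base point. -/
def rowDens (ν L : ℝ) (q : ℝ × ℝ) : ℝ :=
  ∑' n : ℤ, (4 * Real.pi * ν)⁻¹ * Real.exp (-((q.1 - n * L) ^ 2 + q.2 ^ 2) / (4 * ν))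

/-- The weighted Gaussian row `e^{y²} ρ_row` (bounded iff `ν ≤ ¼`): the state representing `ρ_row`. -/
def rowFun (ν L : ℝ) (q : ℝ × ℝ) : ℝ :=
  Real.exp (q.2 ^ 2) * rowDens ν L q

/-- The Gaussian row as an element of `E` (genuine for `0 < ν ≤ ¼`, `FrozenRowConcentration` (i)). -/
def gRow (ν L : ℝ) : E := toE (rowFun ν L)

/-- THE HOMOTOPY `H_θ(g) = T(θ g + (1 − θ) g_row)`, `θ ∈ [0,1]`: it freezes the Biot–Savart
self-interaction (`θ = 0`: the CONSTANT map `g ↦ T(g_row)`, law of the frozen Gaussian-row field;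
`θ = 1`: `T` itself). Biot–Savart is affine in the density, so the drift of `H_θ` is `θU_g + (1−θ)U_row`. -/
def Hmap (ν L : ℝ) (θ : ℝ) (g : E) : E :=
  Tmap ν L (θ • g + (1 - θ) • gRow ν L)

/-- The Leray–Schauder tube `Ω = {‖g‖ < R} ∩ {m_L(g) < m₀}` (open in `E`; used with `m₀ = Mν`). -/
def Omega (L R m₀ : ℝ) : Set E := {g | ‖g‖ < R ∧ mom L g < m₀}

/-- STEADY VORTICITY FORM of the stretched class (`γ = ΔU = 1`, period `L`): smooth bounded `L`-periodic
divergence-free `(u, v)` with the shear far field whose vorticity `ω = ∂ₓv − ∂_yu` solves the steady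
vorticity equation `νΔω = ∂ₓ(uω) + ∂_y((v − y)ω)` (`= (U·∇)ω − ω`, `U = (u, v − y)`, `div U = −1`). -/
structure SteadyVorticityForm (ν L : ℝ) (u v : ℝ → ℝ → ℝ) : Prop where
  smooth_u : ContDiff ℝ ∞ (fun q : ℝ × ℝ => u q.1 q.2)
  smooth_v : ContDiff ℝ ∞ (fun q : ℝ × ℝ => v q.1 q.2)
  bounded : ∃ B : ℝ, ∀ x y, |u x y| ≤ B ∧ |v x y| ≤ B
  periodic_u : ∀ x y, u (x + L) y = u x y
  periodic_v : ∀ x y, v (x + L) y = v x y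
  divFree : ∀ x y, dX u x y + dY v x y = 0
  tendsto_u_atTop : ∀ x, Tendsto (fun y => u x y) atTop (𝓝 (1 / 2))
  tendsto_u_atBot : ∀ x, Tendsto (fun y => u x y) atBot (𝓝 (-(1 / 2)))
  tendsto_v_atTop : ∀ x, Tendsto (fun y => v x y) atTop (𝓝 0)
  tendsto_v_atBot : ∀ x, Tendsto (fun y => v x y) atBot (𝓝 0)
  vorticity_eq : ∀ x y, ν * lap (vort u v) x y =
    dX (fun a b => u a b * vort u v a b) x y + dY (fun a b => (v a b - b) * vort u v a b) x y

/-! ## §3 The six registered stubs (statements as named `Prop`s; bodies `sorry`) -/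

/-- **S1 — STEADY STATES FROM THE VORTICITY FORM (pressure reconstruction).** A smooth bounded periodic
divergence-free field with the shear far field, Gaussian-tailed vorticity and the steady vorticity
equation is, for some `C¹` `L`-periodic pressure `p`, a steady classical solution of the stretched 2-D
Navier–Stokes system. Why true: with `F = ((U·∇)u − νΔu, (U·∇)v − v − νΔv)`, `U = (u, v−y)`, one has
`curl F = (U·∇)ω − ω − νΔω = 0` (uses `div (u,v) = 0`), so `F = −∇p` on `ℝ²` (Poincaré lemma); `∇p` is
periodic and the period defect `κ = p(x+L,y) − p(x,y) = ∫₀ᴸ F₁ dx = ⟨uv⟩' − yū' − νū''` vanishes: integrate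
over `y ∈ [Y, Y+1]` and let `Y → ∞` using `ū' = −∫₀ᴸω → 0` (tails), `u, v` bounded and `v → 0`, `u → ½`
(dominated convergence). Size M (Poincaré lemma for `C^∞` curl-free fields on `ℝ²` is not in Mathlib as such). -/
def SteadyOfVorticityForm : Prop :=
  ∀ ν L : ℝ, 0 < ν → 0 < L → ∀ u v : ℝ → ℝ → ℝ, SteadyVorticityForm ν L u v →
    (∃ C : ℝ, ∀ x y, |vort u v x y| ≤ C * Real.exp (-(y ^ 2))) →
    ∃ p : ℝ → ℝ → ℝ, IsSteadyStretchedLayerNSSolution ν 1 1 L u v p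

/-- **S2 — THE FROZEN-FIELD FRAME (linear theory of `T`; Biot–Savart on the cylinder + stationary
Fokker–Planck laws).** For `0 < L`, `0 < ν ≤ ¼`:
(A) `admissible L` is convex and closed and the moment `m_L` is continuous on `E` (routine: periodicity,
symmetry and sign are closed convex constraints; the cell functionals are bounded linear thanks to the
weight `e^{−y²}`);
(B) for every admissible `h` the frozen field `(u_h, v_h − y)` of `ρ_h` HAS a frozen law (Lyapunov function
`y²`, compact `x`; Khasminskii), `statLaw` is one, and `T(h) = e^{y²}·π` is again admissible (an element of
`E`, periodic, point-symmetric by uniqueness + `S`-equivariance, weighted-bounded since tails are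
`e^{−y²/2ν(1+o(1))}` and `ν ≤ ¼`);
(C) on norm-bounded parts of `admissible L`, `T` is continuous (uniqueness of integrable stationary laws,
Bogachev–Krylov–Röckner–Shaposhnikov) and has relatively compact image (interior Schauder/De Giorgi
estimates with drift bounds uniform on the bounded set + uniform Gaussian tails: Arzelà–Ascoli in the
weighted sup norm);
(D) a fixed point `T(g) = g` is CLASSICAL: `ρ_g ∈ C^∞`, its Biot–Savart field is `C^∞`, bounded, periodic,
divergence-free, has the shear far field and curl `−Lρ_g`, and the vorticity equation holds (bootstrap:
`ρ ∈ C^k ⇒ U_ρ ∈ C^{k,α} ⇒ ρ = π(U_ρ) ∈ C^{k+1,α}`).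
Size L (several independent M-sized lemmas; none in Mathlib: periodic Biot–Savart law, existence/uniqueness/
regularity of stationary FP densities on the cylinder). -/
def FrozenFrame : Prop :=
  ∀ L ν : ℝ, 0 < L → 0 < ν → ν ≤ 1 / 4 →
    (Convex ℝ (admissible L) ∧ IsClosed (admissible L) ∧ Continuous (mom L)) ∧
    (∀ h ∈ admissible L,
      IsFrozenLaw ν L (velU L (dens h)) (velV L (dens h)) (statLaw ν L (velU L (dens h)) (velV L (dens h))) ∧
      ((Tmap ν L h : E) : ℝ × ℝ → ℝ) =
        (fun q => Real.exp (q.2 ^ 2) * statLaw ν L (velU L (dens h)) (velV L (dens h)) q.1 q.2) ∧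
      Tmap ν L h ∈ admissible L) ∧
    (∀ R : ℝ, ContinuousOn (Tmap ν L) (admissible L ∩ Metric.closedBall 0 R) ∧
      IsCompact (closure (Tmap ν L '' (admissible L ∩ Metric.closedBall 0 R)))) ∧
    (∀ g ∈ admissible L, Tmap ν L g = g →
      SteadyVorticityForm ν L (velU L (dens g)) (velV L (dens g)) ∧
      ∀ x y, vort (velU L (dens g)) (velV L (dens g)) x y = -L * dens g (x, y))

/-- **S3 — LERAY–SCHAUDER NONLINEAR ALTERNATIVE (abstract; from the tree's Schauder theorem).** In a real
normed space: `C` closed convex, `Ω` open, `p ∈ C ∩ Ω`; a homotopy `H : [0,1] × (C ∩ cl Ω) → C`, jointly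
continuous with relatively compact image, constant `≡ p` at `θ = 0` and WITHOUT fixed points on
`C ∩ ∂Ω` for all `θ`, has a fixed point of `H 1` in `C ∩ Ω`. Why true (Granas' essential-map argument,
no degree theory): `Σ = {x : ∃θ, H θ x = x}` is compact, `⊆ Ω`; Urysohn `λ` (`= 1` on `Σ`, `= 0` off `Ω`);
`G x = H (λ x) x` on `C ∩ cl Ω`, `= p` on `C \ Ω` is a compact continuous self-map of `C`; Schauder
(`Literature.Analysis.Convex.exists_fixedPoint_of_isCompact_closure`) gives `x = G x`, and then `x ∈ Σ`,
`λ x = 1`. Size M (Mathlib + tree only; reusable; Leray–Schauder DEGREE is not needed on this line because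
the `θ = 0` end is a constant map). -/
def LeraySchauderAlternative : Prop :=
  ∀ (X : Type) [NormedAddCommGroup X] [NormedSpace ℝ X] (C Ω : Set X) (H : ℝ → X → X) (p : X),
    Convex ℝ C → IsClosed C → IsOpen Ω → p ∈ C → p ∈ Ω →
    (∀ t ∈ Set.Icc (0 : ℝ) 1, MapsTo (H t) (C ∩ closure Ω) C) →
    ContinuousOn (fun q : ℝ × X => H q.1 q.2) (Set.Icc (0 : ℝ) 1 ×ˢ (C ∩ closure Ω)) →
    IsCompact (closure ((fun q : ℝ × X => H q.1 q.2) '' (Set.Icc (0 : ℝ) 1 ×ˢ (C ∩ closure Ω)))) →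
    (∀ x ∈ C ∩ closure Ω, H 0 x = p) →
    (∀ t ∈ Set.Icc (0 : ℝ) 1, ∀ x ∈ C ∩ frontier Ω, H t x ≠ x) →
    ∃ x ∈ C ∩ Ω, H 1 x = x

/-- **S4 — A-PRIORI BOUNDS AND THE CONCENTRATION GAP (HARDEST; the crux's difficulty lives here).**
There is an absolute `M₁` such that for every `M ≥ M₁`, all short periods `L ≤ L⋆(M)` and all
`ν ≤ ν₀(M, L)`: every admissible fixed point `g = H_θ(g)`, `θ ∈ [0,1]` (a point-symmetric one-signed steady
state of the θ-FROZEN problem) whose concentration moment is `≤ Mν` in fact has moment `< Mν` (the GAP: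
"concentrated cores or slow cat's eyes, nothing in between") and weighted sup norm `< R(ν, L, M)` (a-priori
bound: Nash–Moser `‖ρ‖∞ ≤ C/ν` from the universal identity `ν‖∇ρ^{p/2}‖² = (p/4)‖ρ^{p/2}‖²`, `div U = −1`,
plus Gaussian tails beyond `|y| ≳ sup|v|`). Mechanism for the gap: the streamline-AREA Lyapunov function
`V` of the frozen field (`u·∇V ≡ 0`, orbit-average of `(0,−y)·∇V = −V` by the divergence theorem) with a
cell corrector for fast circulation gives `E_π[V] ≤ Cν`, and the exact virial identities `⟨xu⟩ = −ν`,
`⟨yv⟩ = +ν`, `⟨y²⟩ = 2ν + O(ν²/L)` pin the `y`-spread. Threat family to be excluded inside the proof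
(triage r1-1): staggered unequal two-per-period equilibria `Γ₁` at `nL`, `Γ₂` at `(n+½)L`, moment
`≈ Γ₂L/16` — flux balance forces `Γ₂ = O(e^{−cL/ν})`, far below `Mν`. Size XL. -/
def APrioriConcentrationGap : Prop :=
  ∃ M₁ : ℝ, 0 < M₁ ∧ ∀ M : ℝ, M₁ ≤ M → ∃ Lstar : ℝ, 0 < Lstar ∧ ∀ L : ℝ, 0 < L → L ≤ Lstar →
    ∃ ν₀ : ℝ, 0 < ν₀ ∧ ∀ ν : ℝ, 0 < ν → ν ≤ ν₀ → ∃ R : ℝ, 0 < R ∧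
      ∀ θ ∈ Set.Icc (0 : ℝ) 1, ∀ g ∈ admissible L, Hmap ν L θ g = g → mom L g ≤ M * ν →
        ‖g‖ < R ∧ mom L g < M * ν

/-- **S5 — THE BASE POINT IS CONCENTRATED (frozen Gaussian-row law).** For short periods and small `ν`:
(i) the weighted Gaussian row is a genuine element of `E` (summable, continuous, bounded for `ν ≤ ¼`) and
admissible (periodic, point-symmetric, nonnegative, unit mass per cell); (ii) EVERY stationary law (weak,
Gaussian-tailed probability density) of the linear diffusion in ITS frozen field `(u_row, v_row − y)` has
concentration moment `∫_cell π w_L ≤ M₀ν` with an absolute `M₀` (a statement about one explicit linear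
Fokker–Planck equation; no operator `T` involved). Why true: near a core the frozen field is a Gaussian
vortex of circulation `−L` (rotation rate `L/8πν ≫ 1`) in the strain `(0, −y)` plus the images' strain
`π/6L` at 45°; rotation averaging gives the
radial drift `−r/2`, law `≈ e^{−r²/4ν}/(4πν)`, moment `≈ 4ν`; outside the cores every point drains into a
core disc in time `≈ 2 log(L/√ν)` (no closed streamlines: `div = −1`), so the outer mass is `o(ν)`.
Kit evidence (triage r1-1 j010784, r1-3 j010795/j013360): `m/ν = 4.0–4.3` at `ν/L² = 10⁻³` for
`L ∈ {¼, ½, 1, 2}`, `≤ 5.6` at `ν/L² = 5·10⁻⁴…4·10⁻³`. Size M–L (a LINEAR problem: Lyapunov function +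
averaging lemma for one explicit drift). -/
def FrozenRowConcentration : Prop :=
  ∃ M₀ : ℝ, 0 < M₀ ∧ ∃ L₀ : ℝ, 0 < L₀ ∧ ∀ L : ℝ, 0 < L → L ≤ L₀ →
    ∃ ν₁ : ℝ, 0 < ν₁ ∧ ν₁ ≤ 1 / 4 ∧ ∀ ν : ℝ, 0 < ν → ν ≤ ν₁ →
      (∃ g : E, (g : ℝ × ℝ → ℝ) = rowFun ν L ∧ g ∈ admissible L) ∧
      ∀ π : ℝ → ℝ → ℝ, IsFrozenLaw ν L (velU L (rowDens ν L)) (velV L (rowDens ν L)) π →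
        ∫ q in cell L, π q.1 q.2 * wgt L q ≤ M₀ * ν

/-- **S6 — THE DISSIPATION FLOOR FROM CONCENTRATION (read-out).** If the vorticity of a `C¹` `L`-periodic
field is `−Lρ` for a continuous probability density `ρ` on the cell with `∫_cell ρ·w_L ≤ Mν` and
`32Mν ≤ L²`, then `layerDissipation ν L u v ≥ L/(64M)`. Why true: Chebyshev puts mass `≥ ½` of `ρ` where
`w_L < 2Mν`, i.e. (cap inactive as `32Mν ≤ L²`) in the sup-metric squares of side `2r`, `r² = 2Mν`, around
`(0,0)` and `(L,0)`; by periodicity these are one full square around the origin carrying `∫|ω| ≥ L/2`;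
Cauchy–Schwarz and `ω² ≤ 2|∇(u,v)|²` give `∫_cell |∇(u,v)|² ≥ (L/2)²/(2·4r²) = L²/(64Mν)`, times `ν/L`.
Size M (the ball form is already PROVED: triage r1-2 evidence `FloorFromConcentration.lean`, 0 sorry). -/
def FloorFromConcentration : Prop :=
  ∀ ν L M : ℝ, 0 < ν → 0 < L → 0 < M → 32 * M * ν ≤ L ^ 2 →
    ∀ (u v : ℝ → ℝ → ℝ) (ρ : ℝ × ℝ → ℝ),
      ContDiff ℝ 1 (fun q : ℝ × ℝ => u q.1 q.2) → ContDiff ℝ 1 (fun q : ℝ × ℝ => v q.1 q.2) →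
      (∀ x y, u (x + L) y = u x y) → (∀ x y, v (x + L) y = v x y) →
      Continuous ρ → (∀ q, 0 ≤ ρ q) → (∫ q in cell L, ρ q = 1) → (∫ q in cell L, ρ q * wgt L q ≤ M * ν) →
      (∀ x y, vort u v x y = -L * ρ (x, y)) →
      ENNReal.ofReal (L / (64 * M)) ≤ layerDissipation ν L u v

theorem stub_steadyOfVorticityForm : SteadyOfVorticityForm := by
  sorry

theorem stub_frozenFrame : FrozenFrame := by
  sorry

theorem stub_leraySchauderAlternative : LeraySchauderAlternative := by
  sorry

theorem stub_aprioriConcentrationGap : APrioriConcentrationGap := by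
  sorry

theorem stub_frozenRowConcentration : FrozenRowConcentration := by
  sorry

theorem stub_floorFromConcentration : FloorFromConcentration := by
  sorry


/-! ## §4 Proved glue I: membership lemmas -/

theorem mem_Omega {L R m₀ : ℝ} {g : E} : g ∈ Omega L R m₀ ↔ ‖g‖ < R ∧ mom L g < m₀ := Iff.rfl

theorem mem_admissible {L : ℝ} {g : E} :
    g ∈ admissible L ↔ (∀ q : ℝ × ℝ, g (q.1 + L, q.2) = g q) ∧ (∀ q : ℝ × ℝ, g (-q.1, -q.2) = g q) ∧
      (∀ q, 0 ≤ g q) ∧ mass L g = 1 := Iff.rfl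

theorem Hmap_zero (ν L : ℝ) (g : E) : Hmap ν L 0 g = Tmap ν L (gRow ν L) := by
  simp [Hmap]

theorem Hmap_one (ν L : ℝ) (g : E) : Hmap ν L 1 g = Tmap ν L g := by
  simp [Hmap]

/-- Pointwise bound of a state by its norm. -/
theorem abs_apply_le_norm (g : E) (q : ℝ × ℝ) : |g q| ≤ ‖g‖ := by
  rw [← Real.norm_eq_abs]
  exact BoundedContinuousFunction.norm_coe_le_norm g q

/-- `toE` returns the element it is given the coercion of. -/
theorem toE_eq_of_coe {f : ℝ × ℝ → ℝ} {g : E} (hg : (g : ℝ × ℝ → ℝ) = f) : toE f = g := by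
  classical
  have h : ∃ g' : E, (g' : ℝ × ℝ → ℝ) = f := ⟨g, hg⟩
  unfold toE
  rw [dif_pos h]
  exact DFunLike.coe_injective (h.choose_spec.trans hg.symm)

/-- Unweighting a weighted function: `(e^{y²} a) e^{−y²} = a`. -/
theorem exp_sq_mul_mul_exp_neg_sq (y a : ℝ) : Real.exp (y ^ 2) * a * Real.exp (-(y ^ 2)) = a := by
  rw [mul_comm (Real.exp _) a, mul_assoc, ← Real.exp_add, add_neg_cancel, Real.exp_zero, mul_one]

theorem mem_closedBall_zero_of_norm_le {g : E} {r : ℝ} (h : ‖g‖ ≤ r) :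
    g ∈ Metric.closedBall (0 : E) r :=
  mem_closedBall_zero_iff.2 h

theorem norm_le_of_mem_closedBall_zero {g : E} {r : ℝ} (h : g ∈ Metric.closedBall (0 : E) r) :
    ‖g‖ ≤ r :=
  mem_closedBall_zero_iff.1 h

/-! ## §4 Proved glue II: the small-period typed statement `C⁺ ⇒` and period multiplication

The reduction "WLOG short periods" is the standing disprover's §7 (`Cruxes/StretchedVortexRows/Disproof.lean`,
`layerDissipation_nat_mul`, `stretchedVortexRows_iff_le_one`, refuter-cdisprove-stmt-AnomalousDissipation-3009,
2026-08-15); the lemmas below are re-proved here (adapted nearly verbatim, with the threshold `1` replaced by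
the line's `L⋆ ≤ 1`) so that the skeleton does not import a refuter workfile. -/

/-- The SMALL-PERIOD TYPED FORM the line proves: a constant `c` and a threshold `L⋆ ≤ 1` such that for
every period `L ≤ L⋆` and all small `ν` the steady class has a member dissipating `≥ c·L` per unit area. -/
def RowsSmallPeriod : Prop :=
  ∃ c : ℝ, 0 < c ∧ ∃ Ls : ℝ, 0 < Ls ∧ Ls ≤ 1 ∧ ∀ L : ℝ, 0 < L → L ≤ Ls → ∃ ν₀ : ℝ, 0 < ν₀ ∧
    ∀ ν : ℝ, 0 < ν → ν ≤ ν₀ → ∃ u v p : ℝ → ℝ → ℝ, IsSteadyStretchedLayerNSSolution ν 1 1 L u v p ∧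
      ENNReal.ofReal (c * L) ≤ layerDissipation ν L u v

/-- `L`-periodicity in `x` implies `mL`-periodicity for every `m : ℕ`. [folklore; Disproof §7] -/
theorem periodic_nat_mul {L : ℝ} {f : ℝ → ℝ → ℝ} (hf : ∀ x y, f (x + L) y = f x y) (m : ℕ) :
    ∀ x y, f (x + m * L) y = f x y := by
  induction m with
  | zero => intro x y; simp
  | succ m ih =>
    intro x y
    have : x + ((m + 1 : ℕ) : ℝ) * L = (x + m * L) + L := by push_cast; ring
    rw [this, hf, ih]

/-- An `L`-periodic steady member is an `mL`-periodic steady member (`m : ℕ`). [folklore; Disproof §7] -/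
theorem isSteady_nat_mul {ν L : ℝ} {u v p : ℝ → ℝ → ℝ} (h : IsSteadyStretchedLayerNSSolution ν 1 1 L u v p)
    (m : ℕ) : IsSteadyStretchedLayerNSSolution ν 1 1 (m * L) u v p where
  contDiff_u := h.contDiff_u
  contDiff_v := h.contDiff_v
  contDiff_p := h.contDiff_p
  momentum_x := h.momentum_x
  momentum_y := h.momentum_y
  divFree := h.divFree
  periodic_u := periodic_nat_mul h.periodic_u m
  periodic_v := periodic_nat_mul h.periodic_v m
  periodic_p := periodic_nat_mul h.periodic_p m
  tendsto_u_atTop := h.tendsto_u_atTop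
  tendsto_u_atBot := h.tendsto_u_atBot
  tendsto_v_atTop := h.tendsto_v_atTop
  tendsto_v_atBot := h.tendsto_v_atBot

/-- `∂ₓ` of an `x`-periodic field is `x`-periodic. [folklore; Disproof §7] -/
theorem dX_periodic {L : ℝ} {f : ℝ → ℝ → ℝ} (hf : ∀ x y, f (x + L) y = f x y) (x y : ℝ) :
    dX f (x + L) y = dX f x y := by
  have hfun : (fun s => f (s + L) y) = fun s => f s y := funext fun s => hf s y
  rw [dX, dX, ← deriv_comp_add_const, hfun]

/-- `∂_y` of an `x`-periodic field is `x`-periodic. [folklore; Disproof §7] -/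
theorem dY_periodic {L : ℝ} {f : ℝ → ℝ → ℝ} (hf : ∀ x y, f (x + L) y = f x y) (x y : ℝ) :
    dY f (x + L) y = dY f x y := by
  have hfun : (fun s => f (x + L) s) = fun s => f x s := funext fun s => hf x s
  rw [dY, dY, hfun]

/-- The lower integral of an `L`-periodic `ℝ≥0∞`-valued function over a period does not depend on where the
period starts (Mathlib `AddCircle.lintegral_preimage`). [folklore; Disproof §7] -/
theorem lintegral_Ioc_periodic {L : ℝ} (hL : 0 < L) {F : ℝ → ℝ≥0∞} (hF : Function.Periodic F L) (t : ℝ) :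
    ∫⁻ x in Ioc t (t + L), F x = ∫⁻ x in Ioc 0 L, F x := by
  haveI : Fact (0 < L) := ⟨hL⟩
  have h1 : ∫⁻ x in Ioc t (t + L), F x = ∫⁻ b : AddCircle L, hF.lift b :=
    AddCircle.lintegral_preimage L t hF.lift
  have h2 : ∫⁻ x in Ioc 0 (0 + L), F x = ∫⁻ b : AddCircle L, hF.lift b :=
    AddCircle.lintegral_preimage L 0 hF.lift
  rw [zero_add] at h2
  rw [h1, h2]

/-- Over `m` periods the lower integral of an `L`-periodic function is `m` times that over one.
[folklore; Disproof §7] -/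
theorem lintegral_Ioc_nat_mul {L : ℝ} (hL : 0 < L) {F : ℝ → ℝ≥0∞} (hF : Function.Periodic F L) (m : ℕ) :
    ∫⁻ x in Ioc 0 ((m : ℝ) * L), F x = m * ∫⁻ x in Ioc 0 L, F x := by
  induction m with
  | zero => simp
  | succ m ih =>
    have hmL : 0 ≤ (m : ℝ) * L := by positivity
    have hsplit : Ioc (0 : ℝ) (((m + 1 : ℕ) : ℝ) * L) =
        Ioc 0 ((m : ℝ) * L) ∪ Ioc ((m : ℝ) * L) ((m : ℝ) * L + L) := by
      push_cast
      rw [add_mul, one_mul, Ioc_union_Ioc_eq_Ioc hmL (by linarith)]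
    rw [hsplit, lintegral_union measurableSet_Ioc (Ioc_disjoint_Ioc_of_le le_rfl), ih,
      lintegral_Ioc_periodic hL hF ((m : ℝ) * L)]
    push_cast
    ring

/-- **Dissipation per unit area is period-blind**: for `x`-periodic `u, v` (period `L > 0`) and `m ≥ 1`,
`layerDissipation ν (mL) u v = layerDissipation ν L u v`. [folklore; Disproof §7] -/
theorem layerDissipation_nat_mul {ν L : ℝ} (hν : 0 ≤ ν) (hL : 0 < L) {u v : ℝ → ℝ → ℝ}
    (hu : ∀ x y, u (x + L) y = u x y) (hv : ∀ x y, v (x + L) y = v x y) {m : ℕ} (hm : 0 < m) :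
    layerDissipation ν (m * L) u v = layerDissipation ν L u v := by
  rw [layerDissipation_def, layerDissipation_def]
  set F : ℝ → ℝ≥0∞ := fun x => ∫⁻ y, ENNReal.ofReal
    (dX u x y ^ 2 + dY u x y ^ 2 + dX v x y ^ 2 + dY v x y ^ 2) with hFdef
  have hF : Function.Periodic F L := by
    intro x
    simp only [hFdef, dX_periodic hu, dY_periodic hu, dX_periodic hv, dY_periodic hv]
  have hmpos : (0 : ℝ) < m := by exact_mod_cast hm
  change ENNReal.ofReal (ν / (m * L)) * ∫⁻ x in Ioc 0 ((m : ℝ) * L), F x =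
    ENNReal.ofReal (ν / L) * ∫⁻ x in Ioc 0 L, F x
  rw [lintegral_Ioc_nat_mul hL hF m, ← mul_assoc, ← ENNReal.ofReal_natCast,
    ← ENNReal.ofReal_mul (by positivity)]
  congr 1
  congr 1
  field_simp

/-- **Period multiplication**: the small-period typed form implies the typed crux for every period
(for `L > L⋆` use the witness of period `L/⌈L/L⋆⌉ ∈ (L⋆/2, L⋆]`, which is `L`-periodic with the same
dissipation per area `> c·L⋆/2`; final constant `c·L⋆/2`). [folklore; Disproof §7 with `1 ↦ L⋆`] -/
theorem typed_of_rowsSmallPeriod (h : RowsSmallPeriod) :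
    ∃ c : ℝ, 0 < c ∧ ∀ L : ℝ, 0 < L → ∃ ν₀ : ℝ, 0 < ν₀ ∧ ∀ ν : ℝ, 0 < ν → ν ≤ ν₀ →
      ∃ u v p : ℝ → ℝ → ℝ, IsSteadyStretchedLayerNSSolution ν 1 1 L u v p ∧
        ENNReal.ofReal (c * min L 1) ≤ layerDissipation ν L u v := by
  obtain ⟨c, hc, Ls, hLs, hLs1, h⟩ := h
  refine ⟨c * Ls / 2, by positivity, fun L hL => ?_⟩
  rcases le_or_gt L Ls with hle | hgt
  · obtain ⟨ν₀, hν₀, hν⟩ := h L hL hle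
    refine ⟨ν₀, hν₀, fun ν hνp hνle => ?_⟩
    obtain ⟨u, v, p, hsol, hD⟩ := hν ν hνp hνle
    refine ⟨u, v, p, hsol, le_trans (ENNReal.ofReal_le_ofReal ?_) hD⟩
    rw [min_eq_left (hle.trans hLs1)]
    have e : c * Ls / 2 * L ≤ c * 1 / 2 * L := by gcongr
    nlinarith [mul_pos hc hL]
  · -- `L > L⋆`: use the witness of period `L' = L/m`, `m = ⌈L/L⋆⌉`
    set m : ℕ := ⌈L / Ls⌉₊ with hm
    have hmge : L / Ls ≤ m := Nat.le_ceil _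
    have hmlt : (m : ℝ) < L / Ls + 1 := Nat.ceil_lt_add_one (by positivity)
    have hLLs : 1 < L / Ls := (one_lt_div hLs).2 hgt
    have hmpos : (0 : ℝ) < m := by linarith
    have hmnat : 0 < m := by exact_mod_cast hmpos
    set L' : ℝ := L / m with hL'
    have hL'pos : 0 < L' := div_pos hL hmpos
    have hmulLe : L ≤ (m : ℝ) * Ls := by
      have := (div_le_iff₀ hLs).1 hmge
      linarith
    have hmulLt : (m : ℝ) * Ls < L + Ls := by
      have h1 : (m : ℝ) * Ls < (L / Ls + 1) * Ls := mul_lt_mul_of_pos_right hmlt hLs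
      have h2 : (L / Ls + 1) * Ls = L + Ls := by field_simp
      linarith
    have hL'le : L' ≤ Ls := by
      rw [hL', div_le_iff₀ hmpos]
      linarith
    have hL'gt : Ls / 2 < L' := by
      rw [hL', lt_div_iff₀ hmpos]
      linarith
    have hmL' : (m : ℝ) * L' = L := by rw [hL']; field_simp
    obtain ⟨ν₀, hν₀, hν⟩ := h L' hL'pos hL'le
    refine ⟨ν₀, hν₀, fun ν hνp hνle => ?_⟩
    obtain ⟨u, v, p, hsol, hD⟩ := hν ν hνp hνle
    refine ⟨u, v, p, ?_, ?_⟩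
    · have := isSteady_nat_mul hsol m
      rwa [hmL'] at this
    · have key : layerDissipation ν L u v = layerDissipation ν L' u v := by
        rw [← hmL']
        exact layerDissipation_nat_mul hνp.le hL'pos hsol.periodic_u hsol.periodic_v hmnat
      rw [key]
      refine le_trans (ENNReal.ofReal_le_ofReal ?_) hD
      have hmin : min L 1 ≤ 1 := min_le_right _ _
      have e1 : c * Ls / 2 * min L 1 ≤ c * Ls / 2 * 1 := mul_le_mul_of_nonneg_left hmin (by positivity)
      have e2 : c * (Ls / 2) < c * L' := mul_lt_mul_of_pos_left hL'gt hc
      linarith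

/-! ## §4 Proved glue III: the inlined crux is the typed statement (Disproof §0, re-proved verbatim) -/

/-- The crux restated over the tree's typed steady class and `layerDissipation` (γ = ΔU = 1).
[folklore; Disproof §0] -/
def StretchedVortexRowsTyped : Prop :=
  ∃ c : ℝ, 0 < c ∧ ∀ L : ℝ, 0 < L → ∃ ν₀ : ℝ, 0 < ν₀ ∧ ∀ ν : ℝ, 0 < ν → ν ≤ ν₀ →
    ∃ u v p : ℝ → ℝ → ℝ, IsSteadyStretchedLayerNSSolution ν 1 1 L u v p ∧
      ENNReal.ofReal (c * min L 1) ≤ layerDissipation ν L u v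

/-- One witness clause of the inlined crux ⇔ the typed structure plus the dissipation bound.
[folklore; Disproof §0] -/
theorem witness_iff (c L ν : ℝ) (u v p : ℝ → ℝ → ℝ) :
    (ContDiff ℝ 2 (fun q : ℝ × ℝ => u q.1 q.2) ∧ ContDiff ℝ 2 (fun q : ℝ × ℝ => v q.1 q.2) ∧
      ContDiff ℝ 1 (fun q : ℝ × ℝ => p q.1 q.2) ∧
      (∀ x y, u x y * dX u x y + (v x y - y) * dY u x y = -dX p x y + ν * (dX (dX u) x y + dY (dY u) x y) ∧
        u x y * dX v x y + (v x y - y) * dY v x y - v x y = -dY p x y + ν * (dX (dX v) x y + dY (dY v) x y) ∧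
        dX u x y + dY v x y = 0) ∧
      (∀ x y, u (x + L) y = u x y ∧ v (x + L) y = v x y ∧ p (x + L) y = p x y) ∧
      (∀ x, Tendsto (fun y => u x y) atTop (𝓝 (1 / 2)) ∧ Tendsto (fun y => u x y) atBot (𝓝 (-(1 / 2))) ∧
        Tendsto (fun y => v x y) atTop (𝓝 0) ∧ Tendsto (fun y => v x y) atBot (𝓝 0)) ∧
      ENNReal.ofReal (c * min L 1) ≤ ENNReal.ofReal (ν / L) *
        ∫⁻ x in Ioc 0 L, ∫⁻ y, ENNReal.ofReal (dX u x y ^ 2 + dY u x y ^ 2 + dX v x y ^ 2 + dY v x y ^ 2)) ↔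
    (IsSteadyStretchedLayerNSSolution ν 1 1 L u v p ∧ ENNReal.ofReal (c * min L 1) ≤ layerDissipation ν L u v) := by
  constructor
  · rintro ⟨hu, hv, hp, hpde, hper, hfar, hD⟩
    refine ⟨⟨hu, hv, hp, ?_, ?_, fun x y => (hpde x y).2.2, fun x y => (hper x y).1,
      fun x y => (hper x y).2.1, fun x y => (hper x y).2.2, ?_, ?_, fun x => (hfar x).2.2.1,
      fun x => (hfar x).2.2.2⟩, hD⟩
    · intro x y; simpa only [one_mul, lap_apply] using (hpde x y).1
    · intro x y; simpa only [one_mul, lap_apply] using (hpde x y).2.1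
    · intro x; simpa using (hfar x).1
    · intro x; simpa using (hfar x).2.1
  · rintro ⟨h, hD⟩
    refine ⟨h.contDiff_u, h.contDiff_v, h.contDiff_p, fun x y => ⟨?_, ?_, h.divFree x y⟩,
      fun x y => ⟨h.periodic_u x y, h.periodic_v x y, h.periodic_p x y⟩,
      fun x => ⟨?_, ?_, h.tendsto_v_atTop x, h.tendsto_v_atBot x⟩, hD⟩
    · simpa only [one_mul, lap_apply] using h.momentum_x x y
    · simpa only [one_mul, lap_apply] using h.momentum_y x y
    · simpa using h.tendsto_u_atTop x
    · simpa using h.tendsto_u_atBot x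

/-- **The inlined crux is the typed statement.** [folklore; Disproof §0] -/
theorem stretchedVortexRows_iff_typed : StretchedVortexRows ↔ StretchedVortexRowsTyped := by
  unfold StretchedVortexRows StretchedVortexRowsTyped
  refine exists_congr fun c => and_congr_right fun _ => forall_congr' fun L => forall_congr' fun _ =>
    exists_congr fun ν₀ => and_congr_right fun _ => forall_congr' fun ν => forall_congr' fun _ =>
    forall_congr' fun _ => exists_congr fun u => exists_congr fun v => exists_congr fun p => ?_
  exact witness_iff c L ν u v p

/-! ## §5 Composition (kernel-checked, sorry-free): the six statements prove the crux -/

/-- **Leray–Schauder + read-out.** From the six stubs, the small-period typed form `RowsSmallPeriod` with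
`c = 1/(64M)`, `M = max(M₀, M₁) + 1`, `L⋆ = min(L₀, L⋆(M), 1)`, `ν₀(L) = min(ν₁, ν₀(M,L), L²/32M)`:
S5 puts the base point `p = T(g_row)` in `C ∩ Ω`, `Ω = {‖g‖ < R'} ∩ {m_L < Mν}`, `R' = max(R, ‖p‖+1)`;
S2 makes `H_θ = T ∘ mix_θ` an admissible-valued jointly continuous compact homotopy on `[0,1] × (C ∩ cl Ω)`
(`mix` is affine-continuous and maps into `C ∩ B(0, R' + ‖g_row‖)` by convexity); S4 keeps its fixed points
off `C ∩ ∂Ω`; S3 gives a fixed point `g = T g ∈ C ∩ Ω`; S2(D) makes it a classical self-consistent state,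
S1 a steady solution `(u, v, p)` with `ω = −Lρ_g`, and S6 reads `layerDissipation ≥ L/(64M)` off
`m_L(g) < Mν`. -/
theorem rowsSmallPeriod_of (h1 : SteadyOfVorticityForm) (h2 : FrozenFrame) (h3 : LeraySchauderAlternative)
    (h4 : APrioriConcentrationGap) (h5 : FrozenRowConcentration) (h6 : FloorFromConcentration) :
    RowsSmallPeriod := by
  obtain ⟨M₀, hM₀, L₀, hL₀, h5⟩ := h5
  obtain ⟨M₁, hM₁, h4⟩ := h4
  obtain ⟨M, hMM₀, hMM₁, hMpos⟩ : ∃ M : ℝ, M₀ < M ∧ M₁ ≤ M ∧ 0 < M :=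
    ⟨max M₀ M₁ + 1, by linarith [le_max_left M₀ M₁], by linarith [le_max_right M₀ M₁],
      by linarith [le_max_left M₀ M₁]⟩
  obtain ⟨Lstar, hLstar, h4⟩ := h4 M hMM₁
  refine ⟨1 / (64 * M), by positivity, min (min L₀ Lstar) 1, lt_min (lt_min hL₀ hLstar) one_pos,
    min_le_right _ _, fun L hL hLle => ?_⟩
  have hLL₀ : L ≤ L₀ := hLle.trans ((min_le_left _ _).trans (min_le_left _ _))
  have hLLs : L ≤ Lstar := hLle.trans ((min_le_left _ _).trans (min_le_right _ _))
  obtain ⟨ν₁, hν₁, hν₁q, h5⟩ := h5 L hL hLL₀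
  obtain ⟨ν₀', hν₀', h4⟩ := h4 L hL hLLs
  have hL2 : 0 < L ^ 2 / (32 * M) := by positivity
  refine ⟨min (min ν₁ ν₀') (L ^ 2 / (32 * M)), lt_min (lt_min hν₁ hν₀') hL2, fun ν hν hνle => ?_⟩
  have hνν₁ : ν ≤ ν₁ := hνle.trans ((min_le_left _ _).trans (min_le_left _ _))
  have hνν₀' : ν ≤ ν₀' := hνle.trans ((min_le_left _ _).trans (min_le_right _ _))
  have hνL : ν ≤ L ^ 2 / (32 * M) := hνle.trans (min_le_right _ _)
  have hν4 : ν ≤ 1 / 4 := hνν₁.trans hν₁q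
  have h32 : 32 * M * ν ≤ L ^ 2 := by
    have := (le_div_iff₀ (by positivity : (0 : ℝ) < 32 * M)).1 hνL
    linarith
  -- the stubs at `(L, ν)`
  obtain ⟨⟨g₀, hg₀, hg₀adm⟩, hrow_mom⟩ := h5 ν hν hνν₁
  obtain ⟨R, hR, hgap⟩ := h4 ν hν hνν₀'
  obtain ⟨⟨hconv, hclosed, hmomc⟩, hB, hC, hD⟩ := h2 L ν hL hν hν4
  -- the Gaussian row is a genuine admissible state, of density `ρ_row`
  have hgRow : gRow ν L = g₀ := toE_eq_of_coe hg₀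
  have hrow_adm : gRow ν L ∈ admissible L := hgRow ▸ hg₀adm
  have hdens_row : dens (gRow ν L) = rowDens ν L := by
    funext q
    rw [dens, hgRow, hg₀, rowFun]
    exact exp_sq_mul_mul_exp_neg_sq q.2 _
  -- the base point `p = T(g_row)` and the tube `Ω`
  set p : E := Tmap ν L (gRow ν L) with hp
  obtain ⟨hp_law, hp_coe, hp_adm⟩ := hB _ hrow_adm
  have hmom_p : mom L p ≤ M₀ * ν := by
    rw [hdens_row] at hp_law hp_coe
    have e : (fun q : ℝ × ℝ => dens p q * wgt L q) = fun q =>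
        statLaw ν L (velU L (rowDens ν L)) (velV L (rowDens ν L)) q.1 q.2 * wgt L q := by
      funext q
      rw [dens, hp_coe]
      exact congrArg (· * wgt L q) (exp_sq_mul_mul_exp_neg_sq q.2 _)
    show (∫ q in cell L, dens p q * wgt L q) ≤ M₀ * ν
    rw [e]
    exact hrow_mom _ hp_law
  obtain ⟨R', hRR', hpR', hR'pos⟩ : ∃ R' : ℝ, R ≤ R' ∧ ‖p‖ < R' ∧ 0 < R' :=
    ⟨max R (‖p‖ + 1), le_max_left _ _, lt_of_lt_of_le (lt_add_one _) (le_max_right _ _),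
      lt_of_lt_of_le hR (le_max_left _ _)⟩
  set Ω : Set E := Omega L R' (M * ν) with hΩ
  have hO1 : IsOpen {g : E | ‖g‖ < R'} := by
    have h : IsOpen (Metric.ball (0 : E) R') := Metric.isOpen_ball
    have e : Metric.ball (0 : E) R' = {g : E | ‖g‖ < R'} := by
      ext g
      rw [mem_ball_zero_iff, Set.mem_setOf_eq]
    rw [e] at h
    exact h
  have hO2 : IsOpen {g : E | mom L g < M * ν} := isOpen_lt hmomc continuous_const
  have hΩopen : IsOpen Ω := hO1.and hO2
  have hpΩ : p ∈ Ω := by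
    refine mem_Omega.2 ⟨hpR', lt_of_le_of_lt hmom_p ?_⟩
    exact mul_lt_mul_of_pos_right hMM₀ hν
  -- `mix_θ(g) = θ g + (1-θ) g_row` maps `[0,1] × C` into `C` (convexity) and bounded sets to bounded sets
  have hmix_adm : ∀ t ∈ Set.Icc (0 : ℝ) 1, ∀ g ∈ admissible L,
      t • g + (1 - t) • gRow ν L ∈ admissible L := by
    intro t ht g hg
    exact hconv hg hrow_adm ht.1 (by linarith [ht.2]) (by ring)
  have hcl_ball : closure Ω ⊆ Metric.closedBall (0 : E) R' :=
    closure_minimal (fun g hg => mem_closedBall_zero_of_norm_le (mem_Omega.1 hg).1.le)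
      Metric.isClosed_closedBall
  have hcl_mom : closure Ω ⊆ {g | mom L g ≤ M * ν} :=
    closure_minimal (fun g hg => (mem_Omega.1 hg).2.le) (isClosed_le hmomc continuous_const)
  -- `mix` maps `B(0,R')` into `B(0,R'')`, `R'' = max R' ‖g_row‖`, by convexity of closed balls
  obtain ⟨R'', hR'R'', hrowR''⟩ : ∃ R'' : ℝ, R' ≤ R'' ∧ ‖gRow ν L‖ ≤ R'' :=
    ⟨max R' ‖gRow ν L‖, le_max_left _ _, le_max_right _ _⟩
  have hmix_ball : ∀ t ∈ Set.Icc (0 : ℝ) 1, ∀ g ∈ Metric.closedBall (0 : E) R',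
      t • g + (1 - t) • gRow ν L ∈ Metric.closedBall (0 : E) R'' := by
    intro t ht g hg
    have hg' : g ∈ Metric.closedBall (0 : E) R'' :=
      mem_closedBall_zero_of_norm_le ((norm_le_of_mem_closedBall_zero hg).trans hR'R'')
    have hrow' : gRow ν L ∈ Metric.closedBall (0 : E) R'' := mem_closedBall_zero_of_norm_le hrowR''
    exact convex_closedBall (0 : E) R'' hg' hrow' ht.1 (by linarith [ht.2]) (by ring)
  obtain ⟨hTcont, hTcomp⟩ := hC R''
  -- hypotheses of the Leray–Schauder alternative
  have hmaps : ∀ t ∈ Set.Icc (0 : ℝ) 1, MapsTo (Hmap ν L t) (admissible L ∩ closure Ω) (admissible L) :=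
    fun t ht g hg => (hB _ (hmix_adm t ht g hg.1)).2.2
  have hmixc : Continuous fun q : ℝ × E => q.1 • q.2 + (1 - q.1) • gRow ν L :=
    (continuous_fst.smul continuous_snd).add ((continuous_const.sub continuous_fst).smul continuous_const)
  have hmixMaps : MapsTo (fun q : ℝ × E => q.1 • q.2 + (1 - q.1) • gRow ν L)
      (Set.Icc (0 : ℝ) 1 ×ˢ (admissible L ∩ closure Ω)) (admissible L ∩ Metric.closedBall 0 R'') := by
    rintro ⟨t, g⟩ ⟨ht, hg, hgcl⟩
    exact ⟨hmix_adm t ht g hg, hmix_ball t ht g (hcl_ball hgcl)⟩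
  have hkey : (fun q : ℝ × E => Hmap ν L q.1 q.2) =
      Tmap ν L ∘ fun q : ℝ × E => q.1 • q.2 + (1 - q.1) • gRow ν L := rfl
  have hHcont : ContinuousOn (fun q : ℝ × E => Hmap ν L q.1 q.2)
      (Set.Icc (0 : ℝ) 1 ×ˢ (admissible L ∩ closure Ω)) := by
    rw [hkey]
    exact hTcont.comp hmixc.continuousOn hmixMaps
  have hHcomp : IsCompact (closure ((fun q : ℝ × E => Hmap ν L q.1 q.2) ''
      (Set.Icc (0 : ℝ) 1 ×ˢ (admissible L ∩ closure Ω)))) := by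
    refine hTcomp.of_isClosed_subset isClosed_closure (closure_mono ?_)
    rintro _ ⟨q, hq, rfl⟩
    exact ⟨_, hmixMaps hq, rfl⟩
  have hH0 : ∀ x ∈ admissible L ∩ closure Ω, Hmap ν L 0 x = p := fun x _ => by
    rw [Hmap_zero]
  have hbdry : ∀ t ∈ Set.Icc (0 : ℝ) 1, ∀ x ∈ admissible L ∩ frontier Ω, Hmap ν L t x ≠ x := by
    rintro t ht x ⟨hxC, hxfr⟩ hfix
    rw [hΩopen.frontier_eq] at hxfr
    obtain ⟨hxcl, hxnot⟩ := hxfr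
    have hmomle : mom L x ≤ M * ν := hcl_mom hxcl
    obtain ⟨hnorm, hmom⟩ := hgap t ht x hxC hfix hmomle
    exact hxnot (mem_Omega.2 ⟨lt_of_lt_of_le hnorm hRR', hmom⟩)
  -- the fixed point
  obtain ⟨g, ⟨hgC, hgΩ⟩, hfix⟩ :=
    h3 E (admissible L) Ω (Hmap ν L) p hconv hclosed hΩopen hp_adm hpΩ hmaps hHcont hHcomp hH0 hbdry
  have hfixT : Tmap ν L g = g := by rwa [Hmap_one] at hfix
  obtain ⟨hgnorm, hgmom⟩ := mem_Omega.1 hgΩ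
  obtain ⟨hSVF, hcurl⟩ := hD g hgC hfixT
  -- S1: a steady classical solution with vorticity `−L ρ_g`
  have htail : ∃ C : ℝ, ∀ x y,
      |vort (velU L (dens g)) (velV L (dens g)) x y| ≤ C * Real.exp (-(y ^ 2)) := by
    refine ⟨L * ‖g‖, fun x y => ?_⟩
    rw [hcurl x y]
    simp only [dens]
    rw [abs_mul, abs_mul, abs_neg, abs_of_pos hL, abs_of_pos (Real.exp_pos _), ← mul_assoc]
    have hg1 := abs_apply_le_norm g (x, y)
    gcongr
  obtain ⟨pr, hsol⟩ := h1 ν L hν hL _ _ hSVF htail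
  -- S6: the floor
  have hcontρ : Continuous (dens g) :=
    g.continuous.mul (Real.continuous_exp.comp (continuous_snd.pow 2).neg)
  have hρnn : ∀ q, 0 ≤ dens g q := fun q => mul_nonneg (hgC.2.2.1 q) (Real.exp_pos _).le
  have h1le : (1 : WithTop ℕ∞) ≤ ((⊤ : ℕ∞) : WithTop ℕ∞) := by exact_mod_cast le_top
  have hfloor := h6 ν L M hν hL hMpos h32 (velU L (dens g)) (velV L (dens g)) (dens g)
    (hSVF.smooth_u.of_le h1le) (hSVF.smooth_v.of_le h1le) hSVF.periodic_u hSVF.periodic_v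
    hcontρ hρnn hgC.2.2.2 hgmom.le hcurl
  refine ⟨velU L (dens g), velV L (dens g), pr, hsol, ?_⟩
  have hc : 1 / (64 * M) * L = L / (64 * M) := by ring
  rw [hc]
  exact hfloor

/-- The composition as one implication chain (its conclusion is the route decl, spelled by name only in
`StretchedVortexRows_of` below so that the skeleton check has a unique by-name candidate). -/
def LineComposition : Prop :=
  SteadyOfVorticityForm → FrozenFrame → LeraySchauderAlternative → APrioriConcentrationGap →
    FrozenRowConcentration → FloorFromConcentration →
    Summit.AnomalousDissipation.AnomalousDissipation.Theses.MarginalStabilityChain.StretchedVortexRows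

/-- **S1 → S2 → S3 → S4 → S5 → S6 → crux** (real proof: Leray–Schauder frame + read-out + period
multiplication + the typed/inlined equivalence). -/
theorem lineComposition : LineComposition := fun h1 h2 h3 h4 h5 h6 =>
  stretchedVortexRows_iff_typed.2 (typed_of_rowsSmallPeriod (rowsSmallPeriod_of h1 h2 h3 h4 h5 h6))

/-- **The skeleton concludes the crux BY NAME**: the six registered stubs, fed to the sorry-free
`lineComposition`, give `Summit.AnomalousDissipation.AnomalousDissipation.Theses.MarginalStabilityChain.StretchedVortexRows`.
No `sorry` of its own; its axiom closure contains `sorryAx` exactly through the six `stub_*`. -/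
theorem StretchedVortexRows_of :
    Summit.AnomalousDissipation.AnomalousDissipation.Theses.MarginalStabilityChain.StretchedVortexRows :=
  lineComposition stub_steadyOfVorticityForm stub_frozenFrame stub_leraySchauderAlternative
    stub_aprioriConcentrationGap stub_frozenRowConcentration stub_floorFromConcentration

end Summit.AnomalousDissipation.AnomalousDissipation.Cruxes.StretchedVortexRows.StationaryMeasure

end
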